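import Summits.FinalStateConjecture.FinalStateConjecture.Theorems.UniformPhotonSphereChannels.Negative.EnergyDefectIdentity

/-!
# Crux `UniformPhotonSphereChannels` (K1), negative side — the commuted field `∂ₓu`

Support file of the standing disprover of item stmt-FinalStateConjecture-10045 (rest-packet pinning).
For `u ∈ C³(ℝ²)` solving `u_tt − u_xx + W u = 0` with `W ∈ C¹`, the spatial derivative
`v = ∂ₓu` (`v z = ∂u(z)(0,1)`) is `C²` and solves the INHOMOGENEOUS equation
`v_tt − v_xx + W v = −(∂ₓW) u`: its defect in the sense of `WaveDefect` is `−(∂ₓW) u`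
(`defect_fderiv_snd`).  Only second-order Fréchet bookkeeping is used: the partials commute for the
`C²` functions `u`, `u_t = ∂u(·)(1,0)` and `v`, and the equation is differentiated in `x`.
The energy of `v` bounds `‖∂ₓu‖²_{L²}` by `E[v]/W_min` — the quantitative "a packet at rest stays
at rest" of the refutation. [folklore]
-/

namespace Summit.FinalStateConjecture.FinalStateConjecture.Theorems

open Set Filter Topology

noncomputable section

namespace WaveDefect

open WaveEnergy

variable {u W : ℝ × ℝ → ℝ}

/-- For `u ∈ C³`, `z ↦ ∂u(z)(e)` is `C²`. -/
theorem contDiff_two_fderiv_apply (hu : ContDiff ℝ 3 u) (e : ℝ × ℝ) :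
    ContDiff ℝ 2 (fun z => fderiv ℝ u z e) :=
  (hu.fderiv_right (m := 2) (by norm_num)).clm_apply contDiff_const

/-- Mixed partials of `u ∈ C³` through the first partials: `∂(u_t)(0,1) = ∂(u_x)(1,0)`. -/
theorem fderiv_ut_snd_eq_fderiv_ux_fst (hu : ContDiff ℝ 3 u) (z : ℝ × ℝ) :
    fderiv ℝ (fun z => fderiv ℝ u z (1, 0)) z (0, 1)
      = fderiv ℝ (fun z => fderiv ℝ u z (0, 1)) z (1, 0) := by
  have hu2 : ContDiff ℝ 2 u := hu.of_le (by norm_num)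
  rw [fderiv_fderiv_apply hu2, fderiv_fderiv_apply hu2, fderiv_fderiv_symm hu2]

/-- `∂ₓ(u_tt) = (∂ₓu)_tt` for `u ∈ C³` (all second partials as `fderiv (fderiv ·)`). -/
theorem fderiv_utt_snd (hu : ContDiff ℝ 3 u) (z : ℝ × ℝ) :
    fderiv ℝ (fun z => fderiv ℝ (fderiv ℝ u) z (1, 0) (1, 0)) z (0, 1)
      = fderiv ℝ (fderiv ℝ (fun z => fderiv ℝ u z (0, 1))) z (1, 0) (1, 0) := by
  have hu2 : ContDiff ℝ 2 u := hu.of_le (by norm_num)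
  have hut : ContDiff ℝ 2 (fun z => fderiv ℝ u z (1, 0)) := contDiff_two_fderiv_apply hu (1, 0)
  have hv : ContDiff ℝ 2 (fun z => fderiv ℝ u z (0, 1)) := contDiff_two_fderiv_apply hu (0, 1)
  -- `u_tt = ∂(u_t)(1,0)` as functions
  have h1 : (fun z => fderiv ℝ (fderiv ℝ u) z (1, 0) (1, 0))
      = fun z => fderiv ℝ (fun z => fderiv ℝ u z (1, 0)) z (1, 0) :=
    funext fun z => (fderiv_fderiv_apply hu2 z (1, 0) (1, 0)).symm
  -- `∂(u_t)(0,1) = ∂(v)(1,0)` as functions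
  have h2 : (fun z => fderiv ℝ (fun z => fderiv ℝ u z (1, 0)) z (0, 1))
      = fun z => fderiv ℝ (fun z => fderiv ℝ u z (0, 1)) z (1, 0) :=
    funext fun z => fderiv_ut_snd_eq_fderiv_ux_fst hu z
  rw [h1, fderiv_fderiv_apply hut, fderiv_fderiv_symm hut, ← fderiv_fderiv_apply hut, h2,
    fderiv_fderiv_apply hv]

/-- `∂ₓ(u_xx) = (∂ₓu)_xx` for `u ∈ C³`. -/
theorem fderiv_uxx_snd (hu : ContDiff ℝ 3 u) (z : ℝ × ℝ) :
    fderiv ℝ (fun z => fderiv ℝ (fderiv ℝ u) z (0, 1) (0, 1)) z (0, 1)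
      = fderiv ℝ (fderiv ℝ (fun z => fderiv ℝ u z (0, 1))) z (0, 1) (0, 1) := by
  have hu2 : ContDiff ℝ 2 u := hu.of_le (by norm_num)
  have hv : ContDiff ℝ 2 (fun z => fderiv ℝ u z (0, 1)) := contDiff_two_fderiv_apply hu (0, 1)
  have h1 : (fun z => fderiv ℝ (fderiv ℝ u) z (0, 1) (0, 1))
      = fun z => fderiv ℝ (fun z => fderiv ℝ u z (0, 1)) z (0, 1) :=
    funext fun z => (fderiv_fderiv_apply hu2 z (0, 1) (0, 1)).symm
  rw [h1, fderiv_fderiv_apply hv]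

/-- **The commuted field.** For `u ∈ C³(ℝ²)`, `W ∈ C¹(ℝ²)` with `u_tt − u_xx + W u = 0`
everywhere, the field `v = ∂ₓu` is `C²` and its defect is `v_tt − v_xx + W v = −(∂ₓW) u`.
[folklore] -/
theorem defect_fderiv_snd (hu : ContDiff ℝ 3 u) (hW : ContDiff ℝ 1 W)
    (hsol : ∀ z : ℝ × ℝ, fderiv ℝ (fderiv ℝ u) z (1, 0) (1, 0)
      - fderiv ℝ (fderiv ℝ u) z (0, 1) (0, 1) + W z * u z = 0) (z : ℝ × ℝ) :
    fderiv ℝ (fderiv ℝ (fun z => fderiv ℝ u z (0, 1))) z (1, 0) (1, 0)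
      - fderiv ℝ (fderiv ℝ (fun z => fderiv ℝ u z (0, 1))) z (0, 1) (0, 1)
      + W z * fderiv ℝ u z (0, 1) = -(fderiv ℝ W z (0, 1) * u z) := by
  have hu2 : ContDiff ℝ 2 u := hu.of_le (by norm_num)
  have hut : ContDiff ℝ 2 (fun z => fderiv ℝ u z (1, 0)) := contDiff_two_fderiv_apply hu (1, 0)
  have hv : ContDiff ℝ 2 (fun z => fderiv ℝ u z (0, 1)) := contDiff_two_fderiv_apply hu (0, 1)
  -- the three terms of the equation as differentiable functions
  set T₁ : ℝ × ℝ → ℝ := fun z => fderiv ℝ (fderiv ℝ u) z (1, 0) (1, 0) with hT₁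
  set T₂ : ℝ × ℝ → ℝ := fun z => fderiv ℝ (fderiv ℝ u) z (0, 1) (0, 1) with hT₂
  have hT₁f : T₁ = fun z => fderiv ℝ (fun z => fderiv ℝ u z (1, 0)) z (1, 0) :=
    funext fun z => (fderiv_fderiv_apply hu2 z (1, 0) (1, 0)).symm
  have hT₂f : T₂ = fun z => fderiv ℝ (fun z => fderiv ℝ u z (0, 1)) z (0, 1) :=
    funext fun z => (fderiv_fderiv_apply hu2 z (0, 1) (0, 1)).symm
  have hT₁d : Differentiable ℝ T₁ := by rw [hT₁f]; exact differentiable_fderiv_apply hut (1, 0)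
  have hT₂d : Differentiable ℝ T₂ := by rw [hT₂f]; exact differentiable_fderiv_apply hv (0, 1)
  have hWd : Differentiable ℝ W := hW.differentiable (by norm_num)
  have hud : Differentiable ℝ u := differentiable_of_contDiff_two hu2
  -- the equation says `T₁ - T₂ + W u = 0` as functions; differentiate it
  have hE : (fun z => T₁ z - T₂ z + W z * u z) = fun _ => (0 : ℝ) := funext fun z => hsol z
  have hD : HasFDerivAt (fun z => T₁ z - T₂ z + W z * u z)
      (fderiv ℝ T₁ z - fderiv ℝ T₂ z + (W z • fderiv ℝ u z + u z • fderiv ℝ W z)) z :=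
    ((hT₁d z).hasFDerivAt.sub (hT₂d z).hasFDerivAt).add
      ((hWd z).hasFDerivAt.mul (hud z).hasFDerivAt)
  have h0 : fderiv ℝ (fun z => T₁ z - T₂ z + W z * u z) z = 0 := by
    rw [hE]; exact fderiv_const_apply 0
  have hkey := congrArg (fun L : ℝ × ℝ →L[ℝ] ℝ => L (0, 1)) (hD.fderiv.symm.trans h0)
  simp only [_root_.add_apply, _root_.sub_apply, _root_.smul_apply, smul_eq_mul, _root_.zero_apply] at hkey
  rw [hT₁, hT₂] at hkey
  rw [← fderiv_utt_snd hu z, ← fderiv_uxx_snd hu z]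
  linarith

end WaveDefect

end

end Summit.FinalStateConjecture.FinalStateConjecture.Theorems
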